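/-
Copyright (c) 2026 the pub-hodgecm-mathlib formalisation cell (harness21).  Prover seat hodgecm-mathlib-K2E2-p12 (g9), Track B «K2-LIT», h413 = `stmt-HodgeConjecture-24833`,
R90-TF section S8 «ContSpec-n½», deal S8-R130 (7′) ∕ S8-R131 (3) ∕ S8-R136 (1) (S8 dealer R90-CS-plan (g3); discharge table `R90/S8/CENSUS-V-DischargeTable.K2E2-p12-g9.md`
3df908fcf11ad296 «=»): THE (V) ASSEMBLY OF LETTERS — socket (V) `sock_S8_res_midBlock_ne_bot`'s bytes HYPOTHESIS-FIRST over exactly the OPEN rows of the table, every ★ ∕ S row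
applied inside.
-/
import Summits.HodgeConjecture.HodgeConjecture.Theorems.R90S8ResGMidBlockNeBotOfLettersU3            -- ★ seam p862780 (K2E2-p12 (g8)): `resGMidBlock_ne_bot_of_letters`, `tendsto_sub_mul_borelConstantTerm`; brings ★ (NV)-rep p862719 (`continuous_residueValue_at`, `residueFun_arithmetic_mul`, `exists_puncturedBall_subset_of_finset`), ★ F5, ★ D1∕D3
import Summits.HodgeConjecture.HodgeConjecture.Theorems.R90S8ResGMidAtomArchStableU3                 -- ★ p863205 (K2E1-p11 (g4)): `midContinuation_quotientSubgroup_mul` (`hEcinv` from D1's clauses)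
import Summits.HodgeConjecture.HodgeConjecture.Theorems.K2E1ChiBorelConstantTermMiddleResidueCMThree -- ★ p862836 (K2E2-p12 (g8)): `tendsto_sub_mul_borelConstantTerm_middle`, `middlePsi_ne_zero` (the CT-residue shape `ρ·Ψ`)
import Summits.HodgeConjecture.HodgeConjecture.Theorems.K2E1ChiScatteringPoleSectionLimitCMThree     -- ★ p862860 (K2E2-p12 (g8)): `tendsto_sub_mul_middle_of_factor_cm_three` (the scattering-pole letter from the factored term)
import Summits.HodgeConjecture.HodgeConjecture.Theorems.K2E1ChiContinuedEisensteinMiddleResidueCMThree -- ★ p862783 (K2E1-p16): T-hr2-2 `exists_L2Residue_of_section` (the `L²` residue of the truncated family, of letters)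
import Summits.HodgeConjecture.HodgeConjecture.Theorems.K2E1ChiEisensteinMiddleResidueMemL2CMThree    -- ★ p862859 (R90-C133-p02): `memLp_quotFun_middleResidue_of_letters` (`hr2` of letters)
import Summits.HodgeConjecture.HodgeConjecture.Theorems.K2E1SiegelTailMemL2CMThree                   -- ★ p862986 (R90-C133-p02): `memLp_two_of_norm_le_ite_supHeight_rpow_cm_three` (the Siegel-top tail `𝟙[T<w₁]·H^{1∕2}` is `L²`)
import Summits.HodgeConjecture.HodgeConjecture.Theorems.K2E1MaassSelbergCMThreeFinal                  -- ★ `exists_structural_datum_cm_three` is NOT used (the table keeps `(ν, 𝓕)` as binders: `hE3` names them); brings ★ `K2E1TruncatedEisensteinL2` (`measurable_quotFun_of_measurable`), Haar unimodularity ★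
import Literature.NumberTheory.Automorphic.AdeleGaloisDescent                                          -- ★ `AdeleRing.ideleBaseChange_posRealIdele` (`z_{L⁺}(t)_L = z_L(t)`)
import Literature.NumberTheory.Automorphic.QuadraticHeckeCharacterCM                                   -- ★ `quadraticHeckeCharCM_sq`, `quadraticHeckeCharCM_infiniteIdeleSingle_eq_one_iff` (the archimedean SIGN of `ε_{L∕L⁺}`)
import Literature.NumberTheory.Automorphic.BookerKrishnamurthyConverse                                 -- ★ `infiniteIdeleSingle` (the idele `ι_v(c)` at one infinite place)
import Literature.NumberTheory.Automorphic.HilbertRepSpectrum                                          -- ★ `ClosedSubrep.toSubmodule_bot` (glue `toSubmodule ≠ ⊥ → ≠ ⊥`)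
import HarnessLib

/-!
# R90-TF · S8 «ContSpec-n½» — `R90S8ResGMidBlockNeBotAssemblyU3`: THE (V) ASSEMBLY OF LETTERS — socket (V) `sock_S8_res_midBlock_ne_bot`'s BYTES
# `LHalfNeZero (ξ.bcη⁻¹ * μω) → resGMidBlock L μ ξ μω ≠ ⊥` IN THE SOCKET FRAME `(L μ μω hμu hμω ξ)`, HYPOTHESIS-FIRST OVER EXACTLY THE OPEN ROWS OF THE (V) DISCHARGE TABLE

Cell `hodgecm-mathlib`, crux H413 (`stmt-HodgeConjecture-24833`, lane `--supports … --as helper`), route of record `HCCMUnconditional`; R90-TF section S8, B ED. 5 socket (V) :300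
(`Cruxes/H413/Lines/R90_S8_ResidualSpectrumU3B.lean`, ecb34c0ba19a543a).  Deal S8-R130 (7′) ∕ S8-R131 (3) ∕ S8-R136 (1) of the S8 dealer R90-CS-plan (g3) on this seat's discharge table
`R90/S8/CENSUS-V-DischargeTable.K2E2-p12-g9.md` (3df908fcf11ad296, verdict «(V) :300 NOT payable tonight» ACCEPTED).  THEOREMS ONLY (no `def`, no `instance`, no notation, no named-fact
hypothesis, no `sorry`; default heartbeats); count-neutral; CLOSES NO SOCKET — it FREEZES socket (V)'s letters: the day the OPEN list is empty, R90-CS-typ2 pays (V) in B by one line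
`fun L _ _ _ μ _ μω hμu hμω ξ => by letI := borel _; haveI : BorelSpace _ := ⟨rfl⟩; exact resGMidBlock_ne_bot_assembly L μ μω hμu hμω ξ …payers…`.

THE ROWS (table 3df908fcf11ad296; «★» = discharged INSIDE by name, «OPEN(owner)» = a binder of the head).
* FRAME: `L μ [IsAutomorphicMeasure μ] μω (hμu : μω.IsUnitary) (hμω : ∀ x, μω (ideleBaseChange x) = quadraticHeckeCharCM L x) ξ` — socket (V)'s, verbatim; plus the Borel structure of
  `G(𝔸)` as instance binders (the socket pays them by `borel _`, `⟨rfl⟩`).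
* (i) GENERATOR DATA — OPEN(exports lineage K2E1-p16 ∕ K2-defs1; non-zero section witness K2E1-p11 (g4) `R90S8ChiSectionPairNonzeroWitnessU3`; χ POLE LEDGER on (1,2] T1-chain successor):
  a level `(K′, ω)`, a continuous section `φ ∈ V(ξ.bcη⁻¹·ξ.bcψ⁻¹·μω, ξ.ψ; K′, ω)` (★ D1 `resGMidAtomGen`'s slot, GENERAL PAIR LEVEL per S8-R136 (1) caution), THE continuation `Ec` with D1's
  clauses (`Sp` finite real ⊂ (1,2], holomorphy on the slit half-plane `{1<Re} ∖ Sp`, `hE2` on the tube, pole letter `Fp` at `3∕2`) and the two LAYER-2 letters (E4) `hE4`, (E2-bd) `hEbd`;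
  «★» `hEcinv` (left-`G(F)`-invariance of `Ec` on the slit plane) = ★ p863205 `midContinuation_quotientSubgroup_mul` from these clauses (`χ₂ = ξ.ψ` automorphic).
* (ii) CONSTANT TERM — binders `(ν, 𝓕)` (any Haar measure of the Heisenberg radical with a fundamental domain of compact closure; ★ `exists_structural_datum_cm_three` inhabits them) and
  OPEN(scalar road R90-CS-p03 (a-2b)∕(a-3) ★ p863248 …, C10-p07, split witness): a punctured-neighbourhood domain `D` of `3∕2` inside the slit plane; the CONTINUED constant-term shape
  `hE3 : (Ec z)_B = φ·H^z + ψ z·H^{2−z}` on `D`; the SCALAR × NORMALISED-SECTION factorisation `hfac : ψ z g = qc z · φt z g` near `3∕2` with `hφt` (continuity of `φt · g` at `3∕2`), ONE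
  point `g₀` with `φt(3∕2) g₀ ≠ 0`, and a sup bound `Cφt` of `φt(3∕2, ·)` (for the Siegel-top tail); «★» `hψ` = ★ p862860 `tendsto_sub_mul_middle_of_factor_cm_three`, `hCT` = ★ p862836
  `tendsto_sub_mul_borelConstantTerm_middle`, `hΨ` = ★ `middlePsi_ne_zero`.
* (iii) F5's LETTERS at `φ := ξ.bcη⁻¹ * μω`, `η := 1` — «★∕S» IN-FILE: `hφu` (§1, socket's `hμu` + ★ `unit_η`), `hφA` (§1: ★ `bcη_ideleBaseChange`, ★ `ideleBaseChange_posRealIdele`, ★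
  `quadraticHeckeCharCM_sq`, socket's `hμω`), `hη`, `hηA`, `hη1 := rfl`, **`hφ1 : ξ.bcη⁻¹ * μω ≠ 1` (§1, the dealer's ARCHIMEDEAN SIGN WITNESS: at a real
  place `v` of `L⁺`, `μω(ι_v(−1)_L) = ε_{L∕L⁺}(ι_v(−1)) ≠ 1` by ★ `quadraticHeckeCharCM_infiniteIdeleSingle_eq_one_iff` while `bcη(ι_v(−1)_L) = 1` by ★ `bcη_ideleBaseChange`)**, `hρ` (★ F5
  `exists_residue_at_threeHalves_cm_three` — the residue-limit `ρ` of `qc` at `3∕2` is OBTAINED, not assumed); OPEN(scalar road): the ramification sets `S`, `T′` (finite, `hurφ`, `hurη`), the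
  scattering scalar `q`∕`qc`∕`P` (`hqcq hPcd hqa` — ★ exports' conjuncts, passed by name by the payer), the Euler factorisation `A`, `hA`, `hsrc` (★ p863248 road), `hA32 : A(3∕2) ≠ 0`.
* (i′) THE `L²` RESIDUE CLASS `f =ᵐ x ↦ Fp((out x)⁻¹)(3∕2)` — «★» INSIDE (§2): `hr2` ★ p862859 `memLp_quotFun_middleResidue_of_letters` ∘ T-hr2-2 ★ p862783 `exists_L2Residue_of_section` (maximiser
  `γ₀` ★ `exists_forall_borelHeight_mul_le`) ∘ Siegel-top tail ★ p862986 `memLp_two_of_norm_le_ite_supHeight_rpow_cm_three` (exponent `½ < 1`; the residue function is continuous ★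
  `continuous_residueValue_at` and left-`G(F)`-invariant ★ `residueFun_arithmetic_mul`, so its descent is Borel ★ `measurable_quotFun_of_measurable`) — OPEN(operator road + Maass–Selberg,
  K2E1-p16's T1 FILE 4 → `hMStube` → ★ p862892 → ★ p862829): a truncation parameter `1 ≤ T`, the `L²`-valued truncated family `Fam` holomorphic on `D` with `hFam : ⇑(Fam z) =ᵐ Λ^T(Ec z)`,
  and the (MS) bound `hMS : ‖(z − 3∕2)•Fam z‖ ≤ C` near `3∕2`.
* (iv) GLUE `(resGMidBlock …).toSubmodule ≠ ⊥ → resGMidBlock … ≠ ⊥` — «★» `ClosedSubrep.toSubmodule_bot` (`rfl`).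
* §1 `isUnitary_bcηInv_mul`, `bcηInv_mul_posRealIdele`, `bcηInv_mul_ne_one` (the sign witness), `heckeChar_one_isUnitary`, `heckeChar_one_posRealIdele`.
* §2 `exists_L2_midResidueClass_of_letters` — the `L²` residue class of a generator from the operator-road letters (rows (i′)).
* §3 HEAD **`resGMidBlock_ne_bot_assembly`** — socket (V)'s conclusion over the frame + exactly the OPEN rows.
HONEST LABEL: HC_CM is proved only modulo the 7 printed citations (2 remaining named inputs: hLiu418 = `stmt-HodgeConjecture-24832`, h413 = `stmt-HodgeConjecture-24833`) until rung 0
closes; (V) :300 stays `sorry` in B ED. 5 — this file freezes its letters and pays none of the OPEN ones; count-neutral.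

## References
* [Rogawski1990] J. D. Rogawski, *Automorphic Representations of Unitary Groups in Three Variables* (1990), §12.1 p. 171, §13.9 (ii) p. 229, Thm. 13.3.6 (b) p. 202.
* [MoeglinWaldspurger1995] C. Mœglin, J.-L. Waldspurger, *Spectral Decomposition and Eisenstein Series* (1995), I.4.11, II.1.7, IV.1.11, V.3.13.
* [Omeara1963] O. T. O'Meara, *Introduction to Quadratic Forms* (1963), §71D (the archimedean sign of the quadratic character).
* [Godement1964] R. Godement, Sém. Bourbaki 1964, §5 Thm. 4.
-/

set_option autoImplicit false
set_option linter.dupNamespace false  -- the mandated namespace `…HodgeConjecture.HodgeConjecture.R90.S8` (LEAD #1 L1) repeats the summit's segment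

noncomputable section

open MeasureTheory Measure NumberField IsDedekindDomain Set Filter Topology Metric
open scoped ENNReal NNReal
open Literature.NumberTheory.Automorphic Literature.NumberTheory.Automorphic.UnitaryGroup Literature.NumberTheory.LFunctions Literature.NumberTheory.GaloisRepresentations AdelicGroupData
open Literature.NumberTheory.Automorphic.Arthur2013.Leaves.TECR Literature.NumberTheory.Rogawski1990 ContRepresentation
open Summit.HodgeConjecture.HodgeConjecture.Cruxes.H413.K2E1BorelEisensteinU
open Summit.HodgeConjecture.HodgeConjecture.Cruxes.H413.K2E1BLBorelSpacesU2Defs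
open Summit.HodgeConjecture.HodgeConjecture.Cruxes.H413.K2E1CharacterEisensteinU3PairDefs
open Summit.HodgeConjecture.HodgeConjecture.Cruxes.H413.K2E1ChiSectionSpaceU3PairDefs
open Summit.HodgeConjecture.HodgeConjecture.Cruxes.H413.K2E1HeckeLHalfNeZeroDefs (LHalfNeZero)
open Summit.HodgeConjecture.HodgeConjecture.Cruxes.H413.K2E1ChiScatteringMiddlePoleU3 (exists_residue_at_threeHalves_cm_three)
open Summit.HodgeConjecture.HodgeConjecture.Cruxes.H413.K2E1ChiBorelConstantTermMiddleResidueCMThree (tendsto_sub_mul_borelConstantTerm_middle middlePsi_ne_zero)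
open Summit.HodgeConjecture.HodgeConjecture.Cruxes.H413.K2E1ChiScatteringPoleSectionLimitCMThree (tendsto_sub_mul_middle_of_factor_cm_three)
open Summit.HodgeConjecture.HodgeConjecture.Cruxes.H413.K2E1ChiContinuedEisensteinMiddleResidueCMThree (exists_L2Residue_of_section)
open Summit.HodgeConjecture.HodgeConjecture.Cruxes.H413.K2E1ChiEisensteinMiddleResidueMemL2CMThree (memLp_quotFun_middleResidue_of_letters)
open Summit.HodgeConjecture.HodgeConjecture.Cruxes.H413.K2E1SiegelTailMemL2CMThree (memLp_two_of_norm_le_ite_supHeight_rpow_cm_three)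
open Summit.HodgeConjecture.HodgeConjecture.Cruxes.H413.K2E1BLHeightCosetsU3 (exists_forall_borelHeight_mul_le)
open Summit.HodgeConjecture.HodgeConjecture.Cruxes.H413.K2E1BLEisensteinInWeightedSpaceU2Weights (supHeight_eq_ciSup_arithmetic)
open Summit.HodgeConjecture.HodgeConjecture.Cruxes.H413.K2E1BLHeckeOperatorWeightedU2 (bddAbove_range_borelHeight_arith_mul)
open Summit.HodgeConjecture.HodgeConjecture.Cruxes.H413.K2E1SphericalHeckeEigenSectionU2 (norm_borelHeight_cpow)
open Summit.HodgeConjecture.HodgeConjecture.Cruxes.H413.K2E1TruncatedEisensteinL2 (measurable_quotFun_of_measurable)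

namespace Summit.HodgeConjecture.HodgeConjecture.R90.S8

variable (L : Type) [Field L] [NumberField L] [IsCMField L]

/-! ## §1 F5's side letters at `φ := ξ.bcη⁻¹ * μω`, `η := 1`, from the socket frame -/

section F5Letters

/-- **`ξ.bcη⁻¹ · μω` IS UNITARY when `μω` is** (`bcη z = η(c̄•z∕z)`, `η` automorphic hence unitary ★ `unit_η`). [cite: Godement1964, §5 Thm. 4] [cite: Rogawski1990, §12.1 p. 171] -/
theorem isUnitary_bcηInv_mul (ξ : OneDimAutRepH L) {μω : HeckeCharacter L} (hμu : μω.IsUnitary) : (ξ.bcη⁻¹ * μω).IsUnitary := fun x => by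
  have hη : ‖((ξ.bcη x : ℂˣ) : ℂ)‖ = 1 := by rw [OneDimAutRepH.bcη_apply]; exact ξ.unit_η _
  rw [HeckeCharacter.mul_apply, HeckeCharacter.inv_apply, Units.val_mul, norm_mul, Units.val_inv_eq_inv_val, norm_inv, hη, hμu x, inv_one, one_mul]

/-- **`ξ.bcη⁻¹ · μω` IS TRIVIAL ON THE POSITIVE REAL IDELES** when `μω` restricts to `ε_{L∕L⁺}` on `𝔸_{L⁺}^×` (socket (V)'s `hμω`): `z_L(t) = z_{L⁺}(t)_L` (★ `ideleBaseChange_posRealIdele`), `bcη`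
is trivial on `𝔸_{L⁺}^×` (★ `bcη_ideleBaseChange`), and `ε² = 1` (★ `quadraticHeckeCharCM_sq`) kills `z_{L⁺}(t) = z_{L⁺}(√t)²`. [cite: Rogawski1990, §12.1 p. 171] [cite: Omeara1963, §71D] -/
theorem bcηInv_mul_posRealIdele (ξ : OneDimAutRepH L) (μω : HeckeCharacter L)
    (hμω : ∀ x : ideleGroup ↥(maximalRealSubfield L), μω (AdeleRing.ideleBaseChange (↥(maximalRealSubfield L)) L x) = quadraticHeckeCharCM L x) (t : ℝ≥0ˣ) :
    (ξ.bcη⁻¹ * μω) (posRealIdele L t) = 1 := by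
  -- `ε² = 1` kills the positive real idele `z(t) = z(√t)²`
  have hsq : ∀ s : ℝ≥0ˣ, quadraticHeckeCharCM L (posRealIdele ↥(maximalRealSubfield L) s) = 1 := fun s => by
    set u : ℝ≥0ˣ := Units.mk0 (NNReal.sqrt (s : ℝ≥0)) (by rw [Ne, NNReal.sqrt_eq_zero]; exact s.ne_zero) with hu
    have hsu : s = u * u := by
      ext
      simp [hu, NNReal.mul_self_sqrt]
    rw [hsu, map_mul, map_mul, ← HeckeCharacter.mul_apply, ← pow_two, quadraticHeckeCharCM_sq L, HeckeCharacter.one_apply]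
  rw [← AdeleRing.ideleBaseChange_posRealIdele (↥(maximalRealSubfield L)) L t, HeckeCharacter.mul_apply, HeckeCharacter.inv_apply, OneDimAutRepH.bcη_ideleBaseChange, hμω,
    hsq, inv_one, one_mul]

/-- **THE ARCHIMEDEAN SIGN WITNESS: `ξ.bcη⁻¹ · μω ≠ 1`** (socket (V)'s `hμω`).  At any infinite (real) place `v` of `L⁺` take the idele `ι_v(−1)` of `L⁺`: `ε_{L∕L⁺}(ι_v(−1)) ≠ 1` (★
`quadraticHeckeCharCM_infiniteIdeleSingle_eq_one_iff`: `= 1 ↔ 0 < −1`), so `μω(ι_v(−1)_L) ≠ 1`, while `bcη(ι_v(−1)_L) = 1` (★ `bcη_ideleBaseChange`): the character takes the value `ε(ι_v(−1)) ≠ 1`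
there.  (This is why `L(s, ξ.bcη⁻¹·μω)` is entire — the `hφ1` letter of ★ F5.) [cite: Omeara1963, §71D] [cite: Rogawski1990, §12.1 p. 171] -/
theorem bcηInv_mul_ne_one (ξ : OneDimAutRepH L) (μω : HeckeCharacter L)
    (hμω : ∀ x : ideleGroup ↥(maximalRealSubfield L), μω (AdeleRing.ideleBaseChange (↥(maximalRealSubfield L)) L x) = quadraticHeckeCharCM L x) :
    ξ.bcη⁻¹ * μω ≠ 1 := by
  intro h1
  obtain ⟨v⟩ : Nonempty (InfinitePlace ↥(maximalRealSubfield L)) := inferInstance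
  set x : ideleGroup ↥(maximalRealSubfield L) := infiniteIdeleSingle v (-1) with hx
  have hval : (ξ.bcη⁻¹ * μω) (AdeleRing.ideleBaseChange (↥(maximalRealSubfield L)) L x) = quadraticHeckeCharCM L x := by
    rw [HeckeCharacter.mul_apply, HeckeCharacter.inv_apply, OneDimAutRepH.bcη_ideleBaseChange, hμω, inv_one, one_mul]
  rw [h1, HeckeCharacter.one_apply] at hval
  have hpos := (quadraticHeckeCharCM_infiniteIdeleSingle_eq_one_iff (L := L) v (-1)).1 hval.symm
  rw [Units.val_neg, Units.val_one, map_neg, map_one] at hpos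
  linarith

/-- The trivial Hecke character is unitary. [folklore] -/
theorem heckeChar_one_isUnitary (K : Type) [Field K] [NumberField K] : (1 : HeckeCharacter K).IsUnitary := fun x => by
  rw [HeckeCharacter.one_apply, Units.val_one, norm_one]

/-- The trivial Hecke character is trivial on the positive real ideles. [folklore] -/
theorem heckeChar_one_posRealIdele (K : Type) [Field K] [NumberField K] (t : ℝ≥0ˣ) : (1 : HeckeCharacter K) (posRealIdele K t) = 1 :=
  HeckeCharacter.one_apply _

end F5Letters

/-! ## §2 The `L²` residue class of a generator, from the operator-road letters (table rows (i′)) -/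

section ResidueClass

variable [MeasurableSpace (quasiSplit (↥(maximalRealSubfield L)) L (IsCMField.complexConj L) 3).Adelic] [BorelSpace (quasiSplit (↥(maximalRealSubfield L)) L (IsCMField.complexConj L) 3).Adelic]
  (μ : Measure (quasiSplit (↥(maximalRealSubfield L)) L (IsCMField.complexConj L) 3).automorphicQuotient) [(quasiSplit (↥(maximalRealSubfield L)) L (IsCMField.complexConj L) 3).IsAutomorphicMeasure μ]

/-- **THE `L²` RESIDUE CLASS OF A GENERATOR AT THE MIDDLE POLE, OF LETTERS** ([MoeglinWaldspurger1995] I.4.11 at `U(2,1)`): for a continued family `Ec` holomorphic on the slit plane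
`{1<Re} ∖ Sp` with the LAYER-2 letters (E4) `hE4`, (E2-bd) `hEbd` and left-`G(F)`-invariance `hEcinv`, a pole letter `Fp` at `3∕2`, the continued constant-term shape `hE3` on a punctured-
neighbourhood domain `D ⊆ {1<Re} ∖ Sp` with the residue letter `hψ : (z − 3∕2)·ψ z g → ρψ g` of its `H^{2−z}`-part, `ρψ` BOUNDED, and the operator road `(Fam, hFd, hFam)` with the (MS) bound
`hMS` near `3∕2`: **there is `f ∈ L²(μ)` with `f =ᵐ x ↦ Fp((out x)⁻¹)(3∕2)`**.  ★ T-hr2-2 p862783 gives the `L²` residue `Res` of the truncated family and `Res =ᵐ r̄ − tail` (`r g := Fp g (3∕2)`,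
`tail = 𝟙[T < w₁]·ρψ(γ₀·)·H(γ₀·)^{1∕2}` at the maximiser ★ `exists_forall_borelHeight_mul_le`); the tail is `L²` by ★ p862986 (`½ < 1`; `H(γ₀y·y) ≤ w₁` ★; `tail =ᵐ r̄ − Res` is a.e.-measurable
because `r` is continuous ★ `continuous_residueValue_at` and left-`G(F)`-invariant ★ `residueFun_arithmetic_mul`, so `r̄` is Borel ★ `measurable_quotFun_of_measurable`); ★ p862859 adds up.
[cite: MoeglinWaldspurger1995, I.4.11, IV.1.11] [cite: Langlands1976, §7] -/
theorem exists_L2_midResidueClass_of_letters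
    (ν : Measure ↥(adelicUnipotent (↥(maximalRealSubfield L)) L (IsCMField.complexConj L) 3)) [ν.IsHaarMeasure]
    {𝓕 : Set ↥(adelicUnipotent (↥(maximalRealSubfield L)) L (IsCMField.complexConj L) 3)}
    (h𝓕N : IsFundamentalDomain ↥(rationalUnipotent (↥(maximalRealSubfield L)) L (IsCMField.complexConj L) 3) 𝓕 ν)
    (Ec : ℂ → (quasiSplit (↥(maximalRealSubfield L)) L (IsCMField.complexConj L) 3).Adelic → ℂ) (Sp : Finset ℂ)
    (hEd : ∀ g, DifferentiableOn ℂ (fun z => Ec z g) ({z : ℂ | 1 < z.re} \ (↑Sp : Set ℂ)))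
    (hE4 : ∀ z ∈ ({z : ℂ | 1 < z.re} \ (↑Sp : Set ℂ)), Continuous (Ec z))
    (hEbd : ∀ z₁ ∈ ({z : ℂ | 1 < z.re} \ (↑Sp : Set ℂ)), ∀ K : Set (quasiSplit (↥(maximalRealSubfield L)) L (IsCMField.complexConj L) 3).Adelic, IsCompact K → ∃ V ∈ 𝓝 z₁, ∃ M : ℝ, ∀ z ∈ V, ∀ g ∈ K, ‖Ec z g‖ ≤ M)
    (hEcinv : ∀ z ∈ ({z : ℂ | 1 < z.re} \ (↑Sp : Set ℂ)), ∀ (γ : (quasiSplit (↥(maximalRealSubfield L)) L (IsCMField.complexConj L) 3).arithmeticSubgroup) (x : (quasiSplit (↥(maximalRealSubfield L)) L (IsCMField.complexConj L) 3).Adelic), Ec z ((γ : (quasiSplit (↥(maximalRealSubfield L)) L (IsCMField.complexConj L) 3).Adelic) * x) = Ec z x)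
    (Fp : (quasiSplit (↥(maximalRealSubfield L)) L (IsCMField.complexConj L) 3).Adelic → ℂ → ℂ) (hF : ∀ g, AnalyticAt ℂ (Fp g) ((3 : ℂ) / 2))
    (hFE : ∀ g, Fp g =ᶠ[𝓝[≠] ((3 : ℂ) / 2)] fun z => (z - (3 : ℂ) / 2) * Ec z g)
    {D : Set ℂ} (hDo : IsOpen D) (hD : ∀ᶠ z in 𝓝[≠] ((3 : ℂ) / 2), z ∈ D) (hDsub : D ⊆ {z : ℂ | 1 < z.re} \ (↑Sp : Set ℂ))
    (φ : (quasiSplit (↥(maximalRealSubfield L)) L (IsCMField.complexConj L) 3).Adelic → ℂ) (ψ : ℂ → (quasiSplit (↥(maximalRealSubfield L)) L (IsCMField.complexConj L) 3).Adelic → ℂ)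
    (ρψ : (quasiSplit (↥(maximalRealSubfield L)) L (IsCMField.complexConj L) 3).Adelic → ℂ) {Cρψ : ℝ} (hρψ : ∀ g, ‖ρψ g‖ ≤ Cρψ)
    (hψ : ∀ g, Tendsto (fun z : ℂ => (z - (3 : ℂ) / 2) * ψ z g) (𝓝[≠] ((3 : ℂ) / 2)) (𝓝 (ρψ g)))
    (hE3 : ∀ z ∈ D, ∀ g : (quasiSplit (↥(maximalRealSubfield L)) L (IsCMField.complexConj L) 3).Adelic,
      borelConstantTerm ν 𝓕 (Ec z) g = φ g * (((borelHeight g : ℝ≥0) : ℝ) : ℂ) ^ z + ψ z g * (((borelHeight g : ℝ≥0) : ℝ) : ℂ) ^ (2 - z))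
    {T : ℝ≥0} (hT : 1 ≤ T) (Fam : ℂ → (quasiSplit (↥(maximalRealSubfield L)) L (IsCMField.complexConj L) 3).L2 μ) (hFd : DifferentiableOn ℂ Fam D)
    (hFam : ∀ z ∈ D, ((Fam z : (quasiSplit (↥(maximalRealSubfield L)) L (IsCMField.complexConj L) 3).L2 μ) : (quasiSplit (↥(maximalRealSubfield L)) L (IsCMField.complexConj L) 3).automorphicQuotient → ℂ) =ᵐ[μ]
      (quasiSplit (↥(maximalRealSubfield L)) L (IsCMField.complexConj L) 3).quotFun (truncation ν 𝓕 T (Ec z)))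
    (hMS : ∃ C : ℝ, ∀ᶠ z in 𝓝[≠] ((3 : ℂ) / 2), ‖(z - (3 : ℂ) / 2) • Fam z‖ ≤ C) :
    ∃ f : (quasiSplit (↥(maximalRealSubfield L)) L (IsCMField.complexConj L) 3).L2 μ,
      (f : (quasiSplit (↥(maximalRealSubfield L)) L (IsCMField.complexConj L) 3).automorphicQuotient → ℂ) =ᵐ[μ] fun x =>
        Fp (Quotient.out (x : (quasiSplit (↥(maximalRealSubfield L)) L (IsCMField.complexConj L) 3).Adelic ⧸ (quasiSplit (↥(maximalRealSubfield L)) L (IsCMField.complexConj L) 3).quotientSubgroup))⁻¹ ((3 : ℂ) / 2) := by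
  haveI := t2Space_adeleRing_of_numberField L
  haveI := locallyCompactSpace_adeleRing' L
  haveI := secondCountableTopology_adeleRing L
  haveI : T2Space (quasiSplit (↥(maximalRealSubfield L)) L (IsCMField.complexConj L) 3).Adelic :=
    inferInstanceAs (T2Space (adelic (↥(maximalRealSubfield L)) L (IsCMField.complexConj L) 3 ((StdForm.antidiagonal 3).over L)))
  haveI : LocallyCompactSpace (quasiSplit (↥(maximalRealSubfield L)) L (IsCMField.complexConj L) 3).Adelic :=
    inferInstanceAs (LocallyCompactSpace (adelic (↥(maximalRealSubfield L)) L (IsCMField.complexConj L) 3 ((StdForm.antidiagonal 3).over L)))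
  haveI : SecondCountableTopology (quasiSplit (↥(maximalRealSubfield L)) L (IsCMField.complexConj L) 3).Adelic :=
    inferInstanceAs (SecondCountableTopology (adelic (↥(maximalRealSubfield L)) L (IsCMField.complexConj L) 3 ((StdForm.antidiagonal 3).over L)))
  -- a Haar measure on `G(𝔸)`, inversion-invariant (unimodular ★), for the Siegel-tail lemma
  haveI : (haar : Measure (quasiSplit (↥(maximalRealSubfield L)) L (IsCMField.complexConj L) 3).Adelic).IsMulRightInvariant :=
    forall_isHaarMeasure_isMulRightInvariant_quasiSplit_cm L (by norm_num : 2 ≤ 3) haar inferInstance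
  haveI : (haar : Measure (quasiSplit (↥(maximalRealSubfield L)) L (IsCMField.complexConj L) 3).Adelic).IsInvInvariant := isInvInvariant_of_isMulRightInvariant _
  -- the maximiser `γ₀` (★ `exists_forall_borelHeight_mul_le`)
  obtain ⟨γ₀, hγ₀⟩ : ∃ γ₀ : (quasiSplit (↥(maximalRealSubfield L)) L (IsCMField.complexConj L) 3).Adelic → (quasiSplit (↥(maximalRealSubfield L)) L (IsCMField.complexConj L) 3).arithmeticSubgroup,
      ∀ (y : (quasiSplit (↥(maximalRealSubfield L)) L (IsCMField.complexConj L) 3).Adelic) (δ : (quasiSplit (↥(maximalRealSubfield L)) L (IsCMField.complexConj L) 3).arithmeticSubgroup),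
        borelHeight ((δ : (quasiSplit (↥(maximalRealSubfield L)) L (IsCMField.complexConj L) 3).Adelic) * y) ≤ borelHeight ((γ₀ y : (quasiSplit (↥(maximalRealSubfield L)) L (IsCMField.complexConj L) 3).Adelic) * y) :=
    ⟨fun y => Classical.choose (exists_forall_borelHeight_mul_le y), fun y δ => Classical.choose_spec (exists_forall_borelHeight_mul_le y) δ⟩
  have hEcinvD : ∀ z ∈ D, ∀ (γ : (quasiSplit (↥(maximalRealSubfield L)) L (IsCMField.complexConj L) 3).arithmeticSubgroup) (x : (quasiSplit (↥(maximalRealSubfield L)) L (IsCMField.complexConj L) 3).Adelic),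
      Ec z ((γ : (quasiSplit (↥(maximalRealSubfield L)) L (IsCMField.complexConj L) 3).Adelic) * x) = Ec z x := fun z hz => hEcinv z (hDsub hz)
  -- ★ T-hr2-2: the `L²` residue `Res` of the truncated family and its a.e. identification `Res = r̄ − tail`
  obtain ⟨Res, -, hRes⟩ := exists_L2Residue_of_section μ ν h𝓕N hT Ec hDo hD hEcinvD φ ψ ρψ hψ hE3 Fp hF hFE γ₀ hγ₀ Fam hFd hFam hMS
  -- the residue function `r g := Fp g (3∕2)`: continuous (★ `continuous_residueValue_at` on the slit plane) and left-`G(F)`-invariant (★ `residueFun_arithmetic_mul`)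
  set r : (quasiSplit (↥(maximalRealSubfield L)) L (IsCMField.complexConj L) 3).Adelic → ℂ := fun g => Fp g ((3 : ℂ) / 2) with hr
  obtain ⟨ρ', hρ', hρ'D⟩ := exists_puncturedBall_subset_of_finset Sp
  have hDo' : IsOpen ({z : ℂ | 1 < z.re} \ (↑Sp : Set ℂ)) := (isOpen_lt continuous_const Complex.continuous_re).sdiff Sp.finite_toSet.isClosed
  have hrc : Continuous r := continuous_residueValue_at Ec hDo' hρ' hρ'D hEd hE4 hEbd Fp hF hFE
  have hrlim : ∀ g, Tendsto (fun z : ℂ => (z - (3 : ℂ) / 2) * Ec z g) (𝓝[≠] ((3 : ℂ) / 2)) (𝓝 (r g)) := fun g =>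
    (tendsto_nhdsWithin_of_tendsto_nhds (hF g).continuousAt.tendsto).congr' (hFE g)
  have hrG : ∀ (γ : (quasiSplit (↥(maximalRealSubfield L)) L (IsCMField.complexConj L) 3).arithmeticSubgroup) (x : (quasiSplit (↥(maximalRealSubfield L)) L (IsCMField.complexConj L) 3).Adelic),
      r ((γ : (quasiSplit (↥(maximalRealSubfield L)) L (IsCMField.complexConj L) 3).Adelic) * x) = r x := residueFun_arithmetic_mul Ec hD hEcinvD hrlim
  have hrm : Measurable ((quasiSplit (↥(maximalRealSubfield L)) L (IsCMField.complexConj L) 3).quotFun r) := measurable_quotFun_of_measurable hrc.measurable hrG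
  -- the Siegel-top tail
  set tail : (quasiSplit (↥(maximalRealSubfield L)) L (IsCMField.complexConj L) 3).automorphicQuotient → ℂ := fun x =>
    if T < supHeight (↥(maximalRealSubfield L)) L (IsCMField.complexConj L) 3 x then
      ρψ ((γ₀ (Quotient.out (x : (quasiSplit (↥(maximalRealSubfield L)) L (IsCMField.complexConj L) 3).Adelic ⧸ (quasiSplit (↥(maximalRealSubfield L)) L (IsCMField.complexConj L) 3).quotientSubgroup))⁻¹ : (quasiSplit (↥(maximalRealSubfield L)) L (IsCMField.complexConj L) 3).Adelic) *
          (Quotient.out (x : (quasiSplit (↥(maximalRealSubfield L)) L (IsCMField.complexConj L) 3).Adelic ⧸ (quasiSplit (↥(maximalRealSubfield L)) L (IsCMField.complexConj L) 3).quotientSubgroup))⁻¹) *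
        (((borelHeight ((γ₀ (Quotient.out (x : (quasiSplit (↥(maximalRealSubfield L)) L (IsCMField.complexConj L) 3).Adelic ⧸ (quasiSplit (↥(maximalRealSubfield L)) L (IsCMField.complexConj L) 3).quotientSubgroup))⁻¹ : (quasiSplit (↥(maximalRealSubfield L)) L (IsCMField.complexConj L) 3).Adelic) *
          (Quotient.out (x : (quasiSplit (↥(maximalRealSubfield L)) L (IsCMField.complexConj L) 3).Adelic ⧸ (quasiSplit (↥(maximalRealSubfield L)) L (IsCMField.complexConj L) 3).quotientSubgroup))⁻¹) : ℝ≥0) : ℝ) : ℂ) ^ (2 - (3 : ℂ) / 2)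
    else 0 with htail
  have hId : (quasiSplit (↥(maximalRealSubfield L)) L (IsCMField.complexConj L) 3).quotFun r =ᵐ[μ]
      ((Res : (quasiSplit (↥(maximalRealSubfield L)) L (IsCMField.complexConj L) 3).L2 μ) : (quasiSplit (↥(maximalRealSubfield L)) L (IsCMField.complexConj L) 3).automorphicQuotient → ℂ) + tail := by
    filter_upwards [hRes] with x hx
    rw [Pi.add_apply, hx, htail, sub_add_cancel]
    rfl
  have hResm : MemLp ((Res : (quasiSplit (↥(maximalRealSubfield L)) L (IsCMField.complexConj L) 3).L2 μ) : (quasiSplit (↥(maximalRealSubfield L)) L (IsCMField.complexConj L) 3).automorphicQuotient → ℂ) 2 μ :=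
    Lp.memLp Res
  -- the tail is a.e.-strongly measurable (`tail =ᵐ r̄ − Res`) and dominated by `(‖Cρψ‖)·𝟙[T < w₁]·w₁^{1∕2}`
  have htailm : AEStronglyMeasurable tail μ := by
    refine (hrm.aestronglyMeasurable.sub hResm.1).congr ?_
    filter_upwards [hId] with x hx
    rw [Pi.sub_apply, hx, Pi.add_apply, add_sub_cancel_left]
  have hT0 : 0 < T := zero_lt_one.trans_le hT
  have hC0 : 0 ≤ Cρψ := (norm_nonneg _).trans (hρψ 1)
  have hbound : ∀ x, ‖tail x‖ ≤ Cρψ * (if T < supHeight (↥(maximalRealSubfield L)) L (IsCMField.complexConj L) 3 x then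
      (supHeight (↥(maximalRealSubfield L)) L (IsCMField.complexConj L) 3 x : ℝ) ^ ((1 : ℝ) / 2) else 0) := fun x => by
    rw [htail]
    by_cases hx : T < supHeight (↥(maximalRealSubfield L)) L (IsCMField.complexConj L) 3 x
    · simp only [if_pos hx]
      rw [norm_mul, norm_borelHeight_cpow]
      have hre : ((2 : ℂ) - (3 : ℂ) / 2).re = (1 : ℝ) / 2 := by norm_num
      rw [hre]
      refine mul_le_mul (hρψ _) ?_ (Real.rpow_nonneg (NNReal.coe_nonneg _) _) hC0
      refine Real.rpow_le_rpow (NNReal.coe_nonneg _) ?_ (by norm_num)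
      have hle := le_ciSup (bddAbove_range_borelHeight_arith_mul ((Quotient.out (x : (quasiSplit (↥(maximalRealSubfield L)) L (IsCMField.complexConj L) 3).Adelic ⧸ (quasiSplit (↥(maximalRealSubfield L)) L (IsCMField.complexConj L) 3).quotientSubgroup))⁻¹))
        (γ₀ (Quotient.out (x : (quasiSplit (↥(maximalRealSubfield L)) L (IsCMField.complexConj L) 3).Adelic ⧸ (quasiSplit (↥(maximalRealSubfield L)) L (IsCMField.complexConj L) 3).quotientSubgroup))⁻¹)
      rw [← supHeight_eq_ciSup_arithmetic] at hle
      exact_mod_cast hle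
    · simp only [if_neg hx, norm_zero, mul_zero, le_refl]
  have hTail : MemLp tail 2 μ :=
    memLp_two_of_norm_le_ite_supHeight_rpow_cm_three L μ haar (a := (1 : ℝ) / 2) (by norm_num) hT0 htailm hbound
  -- ★ p862859: `r̄ = Res + tail ∈ L²`
  have hr2 : MemLp ((quasiSplit (↥(maximalRealSubfield L)) L (IsCMField.complexConj L) 3).quotFun r) 2 μ := memLp_quotFun_middleResidue_of_letters L μ r hResm hTail hId
  exact ⟨hr2.toLp _, hr2.coeFn_toLp⟩

end ResidueClass

/-! ## §3 HEAD: socket (V)'s bytes over the frame + exactly the OPEN rows -/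

section Assembly

variable [MeasurableSpace (quasiSplit (↥(maximalRealSubfield L)) L (IsCMField.complexConj L) 3).Adelic] [BorelSpace (quasiSplit (↥(maximalRealSubfield L)) L (IsCMField.complexConj L) 3).Adelic]

/-- **THE (V) ASSEMBLY OF LETTERS — `LHalfNeZero (ξ.bcη⁻¹ * μω) → resGMidBlock L μ ξ μω ≠ ⊥` IN SOCKET (V)'s FRAME, OVER EXACTLY THE OPEN ROWS** of the discharge table
3df908fcf11ad296 (module docstring): after the frame `(μ, μω, hμu, hμω, ξ)` the binders are, in order — (i) the generator package at a general pair level `(K′, ω, φ, Ec, Sp, Fp)` with D1's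
clauses and the LAYER-2 letters `hE4 hEbd` [OPEN: exports lineage ∕ non-zero section witness ∕ χ pole ledger]; (ii) the constant-term data `(ν, 𝓕)` and the scalar road's letters on a
punctured-neighbourhood domain `D ⊆ {1<Re} ∖ Sp` of `3∕2`: `hE3`, `hfac`, `hφt`, `g₀`, the sup bound `Cφt` [OPEN: R90-CS-p03 (a-2b)∕(a-3), C10-p07, split witness]; (iii) the scalar road's F5 inputs
`S T′ hS hurφ hT′ hurη q qc P hqcq hPcd hqa A hA hsrc hA32` at `φ := ξ.bcη⁻¹ * μω`, `η := 1` [OPEN: same owner]; (i′) the operator road `T hT Fam hFd hFam hMS` [OPEN: K2E1-p16's T1 FILE 4 →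
`hMStube` → ★ `msRel` → ★ `hMS`].  DISCHARGED INSIDE: `hEcinv` (★ p863205), `hψ` (★ p862860), `hCT`∕`hΨ` (★ p862836), `hφu hφA hη hηA hη1 hφ1` (§1), `hρ` (★ F5 `exists_residue_at_threeHalves_cm_three`),
the `L²` residue class `f hf` (§2), and the glue ★ `ClosedSubrep.toSubmodule_bot`; the conclusion is socket (V)'s, via ★ seam `resGMidBlock_ne_bot_of_letters`.
[cite: Rogawski1990, §13.9 (ii) p. 229] [cite: Rogawski1990, Thm. 13.3.6 (b) p. 202] [cite: MoeglinWaldspurger1995, IV.1.11, I.4.11] -/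
theorem resGMidBlock_ne_bot_assembly
    (μ : Measure (quasiSplit (↥(maximalRealSubfield L)) L (IsCMField.complexConj L) 3).automorphicQuotient) [(quasiSplit (↥(maximalRealSubfield L)) L (IsCMField.complexConj L) 3).IsAutomorphicMeasure μ]
    (μω : HeckeCharacter L) (hμu : μω.IsUnitary)
    (hμω : ∀ x : ideleGroup ↥(maximalRealSubfield L), μω (AdeleRing.ideleBaseChange (↥(maximalRealSubfield L)) L x) = quadraticHeckeCharCM L x)
    (ξ : OneDimAutRepH L)
    -- (i) OPEN: the generator package at a general pair level (★ D1 `resGMidAtomGen` clauses) + the LAYER-2 letters (E4), (E2-bd)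
    (K' : Subgroup (quasiSplit (↥(maximalRealSubfield L)) L (IsCMField.complexConj L) 3).Adelic) (ω : ↥K' →* ℂ)
    (φ : (quasiSplit (↥(maximalRealSubfield L)) L (IsCMField.complexConj L) 3).Adelic → ℂ) (hφ : φ ∈ chiSectionSpacePair (ξ.bcη⁻¹ * ξ.bcψ⁻¹ * μω) ξ.ψ K' (ω : ↥K' → ℂ)) (hφc : Continuous φ)
    (Ec : ℂ → (quasiSplit (↥(maximalRealSubfield L)) L (IsCMField.complexConj L) 3).Adelic → ℂ) (Sp : Finset ℂ) (hSp : ∀ s ∈ Sp, s.im = 0 ∧ 1 < s.re ∧ s.re ≤ 2)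
    (hEd : ∀ g, DifferentiableOn ℂ (fun z => Ec z g) ({z : ℂ | 1 < z.re} \ (↑Sp : Set ℂ)))
    (hE2 : ∀ z : ℂ, 2 < z.re → Ec z = eisensteinSeriesU (flatSectionU φ z))
    (Fp : (quasiSplit (↥(maximalRealSubfield L)) L (IsCMField.complexConj L) 3).Adelic → ℂ → ℂ) (hF : ∀ g, AnalyticAt ℂ (Fp g) ((3 : ℂ) / 2))
    (hFE : ∀ g, Fp g =ᶠ[𝓝[≠] ((3 : ℂ) / 2)] fun z => (z - (3 : ℂ) / 2) * Ec z g)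
    (hE4 : ∀ z ∈ ({z : ℂ | 1 < z.re} \ (↑Sp : Set ℂ)), Continuous (Ec z))
    (hEbd : ∀ z₁ ∈ ({z : ℂ | 1 < z.re} \ (↑Sp : Set ℂ)), ∀ K : Set (quasiSplit (↥(maximalRealSubfield L)) L (IsCMField.complexConj L) 3).Adelic, IsCompact K → ∃ V ∈ 𝓝 z₁, ∃ M : ℝ, ∀ z ∈ V, ∀ g ∈ K, ‖Ec z g‖ ≤ M)
    -- (ii) the constant term's domain data (any Haar `ν`, fundamental domain `𝓕` of compact closure; ★ `exists_structural_datum_cm_three`) and OPEN: the scalar road's letters near `3∕2`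
    (ν : Measure ↥(adelicUnipotent (↥(maximalRealSubfield L)) L (IsCMField.complexConj L) 3)) [ν.IsHaarMeasure]
    {𝓕 : Set ↥(adelicUnipotent (↥(maximalRealSubfield L)) L (IsCMField.complexConj L) 3)}
    (h𝓕N : IsFundamentalDomain ↥(rationalUnipotent (↥(maximalRealSubfield L)) L (IsCMField.complexConj L) 3) 𝓕 ν) (h𝓕c : IsCompact (closure 𝓕))
    {D : Set ℂ} (hDo : IsOpen D) (hD : ∀ᶠ z in 𝓝[≠] ((3 : ℂ) / 2), z ∈ D) (hDsub : D ⊆ {z : ℂ | 1 < z.re} \ (↑Sp : Set ℂ))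
    (ψ φt : ℂ → (quasiSplit (↥(maximalRealSubfield L)) L (IsCMField.complexConj L) 3).Adelic → ℂ)
    (hE3 : ∀ z ∈ D, ∀ g : (quasiSplit (↥(maximalRealSubfield L)) L (IsCMField.complexConj L) 3).Adelic,
      borelConstantTerm ν 𝓕 (Ec z) g = φ g * (((borelHeight g : ℝ≥0) : ℝ) : ℂ) ^ z + ψ z g * (((borelHeight g : ℝ≥0) : ℝ) : ℂ) ^ (2 - z))
    (q qc : ℂ → ℂ) {P : Set ℂ} (hqcq : ∀ z : ℂ, 2 < z.re → qc z = q z) (hPcd : ∀ z₀ : ℂ, ∀ᶠ s in 𝓝[≠] z₀, s ∉ P) (hqa : ∀ z : ℂ, z ∉ P → AnalyticAt ℂ qc z)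
    (hfac : ∀ᶠ z in 𝓝[≠] ((3 : ℂ) / 2), ∀ g, ψ z g = qc z * φt z g) (hφt : ∀ g, ContinuousAt (fun z => φt z g) ((3 : ℂ) / 2))
    {g₀ : (quasiSplit (↥(maximalRealSubfield L)) L (IsCMField.complexConj L) 3).Adelic} (hg₀ : φt ((3 : ℂ) / 2) g₀ ≠ 0) {Cφt : ℝ} (hφtbd : ∀ g, ‖φt ((3 : ℂ) / 2) g‖ ≤ Cφt)
    -- (iii) OPEN: the scalar road's F5 inputs at `φ := ξ.bcη⁻¹ * μω`, `η := 1` (ramification sets, Euler factorisation, `A(3∕2) ≠ 0`)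
    {S : Set (HeightOneSpectrum (𝓞 L))} {T' : Set (HeightOneSpectrum (𝓞 ↥(maximalRealSubfield L)))}
    (hS : S.Finite) (hurφ : ∀ w ∉ S, (ξ.bcη⁻¹ * μω).IsUnramifiedAt w) (hT' : T'.Finite) (hurη : ∀ v ∉ T', (1 : HeckeCharacter ↥(maximalRealSubfield L)).IsUnramifiedAt v)
    (A : ℂ → ℂ) (hA : DifferentiableOn ℂ A {z : ℂ | 1 < z.re})
    (hsrc : ∀ z : ℂ, 2 < z.re → q z = A z *
          ((partialStandardL S (fun w => {(ξ.bcη⁻¹ * μω).valueAtUniformizer w}) (z - 1) * partialStandardL T' (fun v => {(1 : HeckeCharacter ↥(maximalRealSubfield L)).valueAtUniformizer v}) (2 * z - 2)) /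
            (partialStandardL S (fun w => {(ξ.bcη⁻¹ * μω).valueAtUniformizer w}) z * partialStandardL T' (fun v => {(1 : HeckeCharacter ↥(maximalRealSubfield L)).valueAtUniformizer v}) (2 * z - 1))))
    (hA32 : A (3 / 2) ≠ 0)
    -- (i′) OPEN: the operator road + the Maass–Selberg bound at the middle pole
    {T : ℝ≥0} (hT : 1 ≤ T) (Fam : ℂ → (quasiSplit (↥(maximalRealSubfield L)) L (IsCMField.complexConj L) 3).L2 μ) (hFd : DifferentiableOn ℂ Fam D)
    (hFam : ∀ z ∈ D, ((Fam z : (quasiSplit (↥(maximalRealSubfield L)) L (IsCMField.complexConj L) 3).L2 μ) : (quasiSplit (↥(maximalRealSubfield L)) L (IsCMField.complexConj L) 3).automorphicQuotient → ℂ) =ᵐ[μ] (quasiSplit (↥(maximalRealSubfield L)) L (IsCMField.complexConj L) 3).quotFun (truncation ν 𝓕 T (Ec z)))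
    (hMS : ∃ C : ℝ, ∀ᶠ z in 𝓝[≠] ((3 : ℂ) / 2), ‖(z - (3 : ℂ) / 2) • Fam z‖ ≤ C) :
    LHalfNeZero (ξ.bcη⁻¹ * μω) → resGMidBlock L μ ξ μω ≠ ⊥ := fun hL => by
  -- (iii) F5's side letters from the frame (§1) and the scalar residue `ρ` (★ F5)
  have hφu : (ξ.bcη⁻¹ * μω).IsUnitary := isUnitary_bcηInv_mul L ξ hμu
  have hφA : ∀ t : ℝ≥0ˣ, (ξ.bcη⁻¹ * μω) (posRealIdele L t) = 1 := bcηInv_mul_posRealIdele L ξ μω hμω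
  have hη : (1 : HeckeCharacter ↥(maximalRealSubfield L)).IsUnitary := heckeChar_one_isUnitary ↥(maximalRealSubfield L)
  have hηA : ∀ t : ℝ≥0ˣ, (1 : HeckeCharacter ↥(maximalRealSubfield L)) (posRealIdele ↥(maximalRealSubfield L) t) = 1 := heckeChar_one_posRealIdele ↥(maximalRealSubfield L)
  have hφ1 : ξ.bcη⁻¹ * μω ≠ 1 := bcηInv_mul_ne_one L ξ μω hμω
  obtain ⟨ρ, hρ, -⟩ := exists_residue_at_threeHalves_cm_three L hφu hφA hS hurφ hη hηA hT' hurη q qc hqcq hPcd hqa A hA hsrc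
  -- (ii) the constant term of the residue: `(z − 3∕2)·(Ec z)_B(g) → ρ·Ψ(g)`, `Ψ = φt(3∕2)·H^{1∕2}`, `Ψ(g₀) ≠ 0` (★ p862860, ★ p862836)
  have hψ := tendsto_sub_mul_middle_of_factor_cm_three ψ qc φt hfac hφt hρ
  have hCT : ∀ g, Tendsto (fun z : ℂ => (z - (3 : ℂ) / 2) * borelConstantTerm ν 𝓕 (Ec z) g) (𝓝[≠] ((3 : ℂ) / 2))
      (𝓝 (ρ * (φt ((3 : ℂ) / 2) g * (((borelHeight g : ℝ≥0) : ℝ) : ℂ) ^ ((1 : ℂ) / 2)))) :=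
    fun g => tendsto_sub_mul_borelConstantTerm_middle ν 𝓕 Ec hD φ ψ (φt ((3 : ℂ) / 2)) hψ hE3 g
  have hΨ := middlePsi_ne_zero (φt ((3 : ℂ) / 2)) hg₀
  -- (i) left-`G(F)`-invariance of `Ec` on the slit plane (★ p863205, from D1's clauses; `ξ.ψ` automorphic)
  have hφξ : IsChiSectionPair (F := ↥(maximalRealSubfield L)) (ξ.bcη⁻¹ * ξ.bcψ⁻¹ * μω) ξ.ψ φ := isChiSectionPair_of_mem hφ
  have hEcinv : ∀ z ∈ ({z : ℂ | 1 < z.re} \ (↑Sp : Set ℂ)), ∀ (γ : (quasiSplit (↥(maximalRealSubfield L)) L (IsCMField.complexConj L) 3).arithmeticSubgroup) (x : (quasiSplit (↥(maximalRealSubfield L)) L (IsCMField.complexConj L) 3).Adelic),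
      Ec z ((γ : (quasiSplit (↥(maximalRealSubfield L)) L (IsCMField.complexConj L) 3).Adelic) * x) = Ec z x := fun z hz γ x =>
    midContinuation_quotientSubgroup_mul L hφξ ξ.hψ (fun s hs => (hSp s hs).1) hEd hE2 ((quasiSplit (↥(maximalRealSubfield L)) L (IsCMField.complexConj L) 3).arithmeticSubgroup_le_quotientSubgroup γ.2) x hz
  -- (i′) the `L²` residue class (§2; `ρψ := ρ·φt(3∕2, ·)` bounded by `‖ρ‖·Cφt`)
  have hρψ : ∀ g, ‖ρ * φt ((3 : ℂ) / 2) g‖ ≤ ‖ρ‖ * Cφt := fun g => by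
    rw [norm_mul]; exact mul_le_mul_of_nonneg_left (hφtbd g) (norm_nonneg _)
  obtain ⟨f, hf⟩ := exists_L2_midResidueClass_of_letters L μ ν h𝓕N Ec Sp hEd hE4 hEbd hEcinv Fp hF hFE hDo hD hDsub φ ψ (fun g => ρ * φt ((3 : ℂ) / 2) g) hρψ hψ hE3 hT Fam hFd hFam hMS
  -- ★ seam + glue
  have hsub := resGMidBlock_ne_bot_of_letters L μ ξ μω K' ω φ hφ hφc Ec Sp hSp hEd hE2 Fp hF hFE hE4 hEbd hEcinv f hf ν h𝓕N h𝓕c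
    (fun g => φt ((3 : ℂ) / 2) g * (((borelHeight g : ℝ≥0) : ℝ) : ℂ) ^ ((1 : ℂ) / 2)) hCT hΨ hφu hφA hS hurφ hη hηA hT' hurη q qc hqcq hPcd hqa A hA hsrc rfl hφ1 hA32 hρ hL
  exact fun hbot => hsub (by rw [hbot, ClosedSubrep.toSubmodule_bot])

end Assembly

end Summit.HodgeConjecture.HodgeConjecture.R90.S8

end
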